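import Summits.CriticalPhenomena.PercolationContinuityZ3.Theorems.Transplant.FKConnectivityAllQHubCovFiber
import HarnessLib

/-!
# Connectivity correlation inequalities for `φ_{w,q}`, every `q > 0` — fiber sums with ARBITRARY integrands and the AM–GM
# REGROUPING CRITERION (certificates beyond coefficientwise positivity)

Helper file (`--supports stmt-CriticalPhenomena-4575`), FK sub-lane `prim-bschramm-fk-3` (gen 10) of the post-continuity programme;
builds on p205010 (kernel theorem, internal audit signed; external expert review pending).  No definitions, no named facts, no sorries;
standard axioms.

fk-1 g6's fiber decomposition (`…HubCovFiber`: `weight_mul_weight_eq_fiber`, `threePoint_eq_fiber_sum`) writes a product of two masses of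
`φ_{U,q}` as `Σ_{(I,J)} c_U(I,J)·P_{I,J}` over the fibers `(ω₁ ∩ ω₂, ω₁ ∪ ω₂) = (I,J)`, with the FIBER CONSTANT
`c_U(I,J) = Π_{g∈I} p_g² Π_{g∈J∖I} p_g(1−p_g) Π_{g∉J} (1−p_g)²`.  Coefficientwise positivity (`P_{I,J} ≥ 0` for every fiber) proves the hub
covariance bound on `K₅` (gen 10, `…K5`) but FAILS for disjoint pairs of `K₅` (112 of 6,561 fiber polynomials of the Rayleigh difference
`Z¹⁰Z⁰¹ − Z¹¹Z⁰⁰` of `(01, 23)` are negative on part of `[0,1]`, bschramm/FK-BARRIER.md §14.4).  This file records the next weaker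
sufficient condition, an AM–GM REGROUPING: the fiber constants of three fibers `A, B, M` whose exponent vectors satisfy `x_A + x_B = 2x_M`
(`x(g) ∈ {0,1,2}` the power of `p_g`) obey `c_A·c_B = c_M²`, hence `c_A + c_B ≥ 2c_M`; so `Σ_d c_d P_d ≥ 0` as soon as nonnegative
weights `μ_m` on such triples make every residual `P_d − Σ_{m: d ∈ {A_m,B_m}} μ_m + 2Σ_{m: d = M_m} μ_m` nonnegative
(**`fiberSum_nonneg_of_amgm`**).  Also: the product of two product-weight sums with arbitrary integrands as a fiber sum
(`weightSum_mul_weightSum_eq_fiber_sum`), the form needed for pinned/mixed products such as `S⁰(x↮y)·Z¹ − S¹(x↮y)·Z⁰` of fk-1's master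
identity `negCorr_defect_eq`.  Nothing is claimed here about the existence of such certificates (LP scoping: FK-BARRIER §14.4).
[cite: Grimmett2006, §1.4 eq. (1.20) (p. 15); §3.9 eq. (3.94) (pp. 63–64)] [cite: Wagner2006, Conj. 5.3, Ex. 5.2 (p. 13)]
-/

noncomputable section

namespace Summit.CriticalPhenomena.PercolationContinuityZ3.Theorems

namespace FK

open MeasureTheory Finset Literature.Probability.LatticeModels Literature.Probability.Percolation
open Literature.Probability.Percolation.BHK2006 (weight weight_nonneg)
open scoped Classical

variable {V : Type*} [Fintype V]

/-! ### Products of product-weight sums as fiber sums (arbitrary integrands) -/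

/-- **Product of two product-weight sums as a fiber sum**, arbitrary integrands `a, b`:
`(Σ_ω W_p(ω) a(ω))·(Σ_ω W_p(ω) b(ω)) = Σ_{(I,J)} c_p(I,J) · Σ_{ω₁∩ω₂=I, ω₁∪ω₂=J} a(ω₁) b(ω₂)` with `W_p` the product weight and `c_p` the
fiber constant. [cite: Grimmett2006, §1.4 eq. (1.20) (p. 15)] -/
theorem weightSum_mul_weightSum_eq_fiber_sum (p : Sym2 V → ℝ) (a b : BondConfig V → ℝ) :
    (∑ ω : BondConfig V, weight p ω * a ω) * (∑ ω : BondConfig V, weight p ω * b ω) =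
      ∑ d : BondConfig V × BondConfig V,
        (∏ g : Sym2 V, (if g ∈ d.1 then p g * p g else if g ∈ d.2 then p g * (1 - p g) else (1 - p g) * (1 - p g))) *
          ∑ pr ∈ (Finset.univ : Finset (BondConfig V × BondConfig V)).filter (fun pr => (pr.1 ∩ pr.2, pr.1 ∪ pr.2) = d),
            a pr.1 * b pr.2 := by
  have h1 : (∑ ω : BondConfig V, weight p ω * a ω) * (∑ ω : BondConfig V, weight p ω * b ω) =
      ∑ pr : BondConfig V × BondConfig V, weight p pr.1 * weight p pr.2 * (a pr.1 * b pr.2) := by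
    rw [Finset.sum_mul_sum, ← Finset.univ_product_univ, Finset.sum_product]
    exact Finset.sum_congr rfl fun ω₁ _ => Finset.sum_congr rfl fun ω₂ _ => by ring
  rw [h1, ← Finset.sum_fiberwise_of_maps_to (s := (Finset.univ : Finset (BondConfig V × BondConfig V)))
    (t := (Finset.univ : Finset (BondConfig V × BondConfig V))) (g := fun pr => (pr.1 ∩ pr.2, pr.1 ∪ pr.2))
    (fun _ _ => Finset.mem_univ _)]
  refine Finset.sum_congr rfl fun d _ => ?_
  rw [Finset.mul_sum]
  refine Finset.sum_congr rfl fun pr hpr => ?_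
  have hd : (pr.1 ∩ pr.2, pr.1 ∪ pr.2) = d := (Finset.mem_filter.1 hpr).2
  subst hd
  rw [weight_mul_weight_eq_fiber]
  ring

/-! ### The AM–GM regrouping criterion -/

/-- **Midpoint fibers have the geometric-mean constant**: if the exponent vectors of `A, B, M` satisfy `x_A(g) + x_B(g) = 2x_M(g)` for every
pair `g` (`x = 2` on the intersection component, `1` on the union, `0` outside; intersections inside unions), then `c_A·c_B = c_M²`.
[folklore] -/
theorem fiberWeight_mul_eq_sq (p : Sym2 V → ℝ) (A B M : BondConfig V × BondConfig V) (hA : A.1 ⊆ A.2) (hB : B.1 ⊆ B.2)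
    (hmid : ∀ g, (if g ∈ A.1 then 2 else if g ∈ A.2 then 1 else 0) + (if g ∈ B.1 then 2 else if g ∈ B.2 then 1 else 0) =
      2 * (if g ∈ M.1 then 2 else if g ∈ M.2 then 1 else (0 : ℕ))) :
    (∏ g : Sym2 V, (if g ∈ A.1 then p g * p g else if g ∈ A.2 then p g * (1 - p g) else (1 - p g) * (1 - p g))) *
        (∏ g : Sym2 V, (if g ∈ B.1 then p g * p g else if g ∈ B.2 then p g * (1 - p g) else (1 - p g) * (1 - p g))) =
      (∏ g : Sym2 V, (if g ∈ M.1 then p g * p g else if g ∈ M.2 then p g * (1 - p g) else (1 - p g) * (1 - p g))) ^ 2 := by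
  rw [← Finset.prod_mul_distrib, sq, ← Finset.prod_mul_distrib]
  refine Finset.prod_congr rfl fun g _ => ?_
  have h := hmid g
  by_cases a1 : g ∈ A.1 <;> by_cases a2 : g ∈ A.2 <;> by_cases b1 : g ∈ B.1 <;> by_cases b2 : g ∈ B.2 <;>
    by_cases m1 : g ∈ M.1 <;> by_cases m2 : g ∈ M.2 <;>
    simp only [a1, a2, b1, b2, m1, m2, if_true, if_false] at h ⊢ <;>
    first | omega | (exact absurd (hA a1) a2) | (exact absurd (hB b1) b2) | ring

/-- **AM–GM for fiber constants**: under the midpoint condition, `2·c_M ≤ c_A + c_B` (parameters in `[0,1]`). [folklore] -/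
theorem two_mul_fiberWeight_le (p : Sym2 V → ℝ) (hp0 : ∀ g, 0 ≤ p g) (hp1 : ∀ g, p g ≤ 1) (A B M : BondConfig V × BondConfig V)
    (hA : A.1 ⊆ A.2) (hB : B.1 ⊆ B.2)
    (hmid : ∀ g, (if g ∈ A.1 then 2 else if g ∈ A.2 then 1 else 0) + (if g ∈ B.1 then 2 else if g ∈ B.2 then 1 else 0) =
      2 * (if g ∈ M.1 then 2 else if g ∈ M.2 then 1 else (0 : ℕ))) :
    2 * (∏ g : Sym2 V, (if g ∈ M.1 then p g * p g else if g ∈ M.2 then p g * (1 - p g) else (1 - p g) * (1 - p g))) ≤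
      (∏ g : Sym2 V, (if g ∈ A.1 then p g * p g else if g ∈ A.2 then p g * (1 - p g) else (1 - p g) * (1 - p g))) +
        (∏ g : Sym2 V, (if g ∈ B.1 then p g * p g else if g ∈ B.2 then p g * (1 - p g) else (1 - p g) * (1 - p g))) := by
  have hsq := fiberWeight_mul_eq_sq p A B M hA hB hmid
  have hA0 := fiberWeight_nonneg p hp0 hp1 A.1 A.2
  have hB0 := fiberWeight_nonneg p hp0 hp1 B.1 B.2
  have hM0 := fiberWeight_nonneg p hp0 hp1 M.1 M.2
  nlinarith [sq_nonneg ((∏ g : Sym2 V, (if g ∈ A.1 then p g * p g else if g ∈ A.2 then p g * (1 - p g) else (1 - p g) * (1 - p g))) -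
    (∏ g : Sym2 V, (if g ∈ B.1 then p g * p g else if g ∈ B.2 then p g * (1 - p g) else (1 - p g) * (1 - p g))))]

/-- **The AM–GM regrouping criterion.**  Let `P_d` be any real numbers indexed by fibers and let finitely many "moves" `m` be given, each a
triple of fibers `(A_m, B_m, M_m)` with the midpoint condition and a weight `μ_m ≥ 0`.  If every residual
`P_d − Σ_{m: A_m = d} μ_m − Σ_{m: B_m = d} μ_m + 2·Σ_{m: M_m = d} μ_m` is `≥ 0`, then `Σ_d c_p(d)·P_d ≥ 0` for all parameters in `[0,1]`
(`(M m).1 ⊆ (M m).2` is not needed; fibers with `d.1 ⊄ d.2` must simply have a nonnegative residual — in applications their fiber set is empty).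
[folklore] -/
theorem fiberSum_nonneg_of_amgm {ι : Type*} (moves : Finset ι) (A B M : ι → BondConfig V × BondConfig V) (μ : ι → ℝ)
    (hμ : ∀ m ∈ moves, 0 ≤ μ m) (hA : ∀ m ∈ moves, (A m).1 ⊆ (A m).2) (hB : ∀ m ∈ moves, (B m).1 ⊆ (B m).2)
    (hmid : ∀ m ∈ moves, ∀ g, (if g ∈ (A m).1 then 2 else if g ∈ (A m).2 then 1 else 0) +
      (if g ∈ (B m).1 then 2 else if g ∈ (B m).2 then 1 else 0) = 2 * (if g ∈ (M m).1 then 2 else if g ∈ (M m).2 then 1 else (0 : ℕ)))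
    (p : Sym2 V → ℝ) (hp0 : ∀ g, 0 ≤ p g) (hp1 : ∀ g, p g ≤ 1) (P : BondConfig V × BondConfig V → ℝ)
    (hres : ∀ d, 0 ≤ P d - (∑ m ∈ moves.filter (fun m => A m = d), μ m) - (∑ m ∈ moves.filter (fun m => B m = d), μ m) +
      2 * ∑ m ∈ moves.filter (fun m => M m = d), μ m) :
    0 ≤ ∑ d : BondConfig V × BondConfig V,
      (∏ g : Sym2 V, (if g ∈ d.1 then p g * p g else if g ∈ d.2 then p g * (1 - p g) else (1 - p g) * (1 - p g))) * P d := by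
  -- abbreviation for the fiber constant
  set c : BondConfig V × BondConfig V → ℝ := fun d =>
    ∏ g : Sym2 V, (if g ∈ d.1 then p g * p g else if g ∈ d.2 then p g * (1 - p g) else (1 - p g) * (1 - p g)) with hc
  have hc0 : ∀ d, 0 ≤ c d := fun d => fiberWeight_nonneg p hp0 hp1 d.1 d.2
  -- the AM–GM part: Σ_m μ_m (c_A + c_B − 2 c_M) ≥ 0
  have hmoves : 0 ≤ ∑ m ∈ moves, μ m * (c (A m) + c (B m) - 2 * c (M m)) := by
    refine Finset.sum_nonneg fun m hm => mul_nonneg (hμ m hm) ?_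
    have := two_mul_fiberWeight_le p hp0 hp1 (A m) (B m) (M m) (hA m hm) (hB m hm) (hmid m hm)
    simp only [hc]
    linarith
  -- the residual part: Σ_d c_d R_d ≥ 0
  have hresid : 0 ≤ ∑ d : BondConfig V × BondConfig V, c d *
      (P d - (∑ m ∈ moves.filter (fun m => A m = d), μ m) - (∑ m ∈ moves.filter (fun m => B m = d), μ m) +
        2 * ∑ m ∈ moves.filter (fun m => M m = d), μ m) :=
    Finset.sum_nonneg fun d _ => mul_nonneg (hc0 d) (hres d)
  -- bookkeeping: Σ_d c_d Σ_{m: X m = d} μ_m = Σ_m μ_m c_{X m}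
  have regroup : ∀ X : ι → BondConfig V × BondConfig V,
      ∑ d : BondConfig V × BondConfig V, c d * ∑ m ∈ moves.filter (fun m => X m = d), μ m = ∑ m ∈ moves, μ m * c (X m) := by
    intro X
    rw [← Finset.sum_fiberwise_of_maps_to (s := moves) (t := (Finset.univ : Finset (BondConfig V × BondConfig V))) (g := X)
      (fun _ _ => Finset.mem_univ _)]
    refine Finset.sum_congr rfl fun d _ => ?_
    rw [Finset.mul_sum]
    refine Finset.sum_congr rfl fun m hm => ?_
    rw [(Finset.mem_filter.1 hm).2, mul_comm]
  have expand : ∑ d : BondConfig V × BondConfig V, c d *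
      (P d - (∑ m ∈ moves.filter (fun m => A m = d), μ m) - (∑ m ∈ moves.filter (fun m => B m = d), μ m) +
        2 * ∑ m ∈ moves.filter (fun m => M m = d), μ m) =
      (∑ d : BondConfig V × BondConfig V, c d * P d) - (∑ m ∈ moves, μ m * c (A m)) - (∑ m ∈ moves, μ m * c (B m)) +
        2 * ∑ m ∈ moves, μ m * c (M m) := by
    rw [← regroup A, ← regroup B, ← regroup M, Finset.mul_sum, ← Finset.sum_sub_distrib, ← Finset.sum_sub_distrib,
      ← Finset.sum_add_distrib]
    exact Finset.sum_congr rfl fun d _ => by ring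
  have hmoves' : ∑ m ∈ moves, μ m * (c (A m) + c (B m) - 2 * c (M m)) =
      (∑ m ∈ moves, μ m * c (A m)) + (∑ m ∈ moves, μ m * c (B m)) - 2 * ∑ m ∈ moves, μ m * c (M m) := by
    rw [Finset.mul_sum, ← Finset.sum_add_distrib, ← Finset.sum_sub_distrib]
    exact Finset.sum_congr rfl fun m _ => by ring
  rw [expand] at hresid
  rw [hmoves'] at hmoves
  simp only [hc] at hresid hmoves ⊢
  linarith

end FK

end Summit.CriticalPhenomena.PercolationContinuityZ3.Theorems

end
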